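import Summits.QuantumFields.BalabanUV.Beta.FP.KKTSecondVariation

/-!
# `BalabanUV.Beta.FP.EffectiveFormJetsMovingBorder` — road «FP» for binder row D1, RULING R-FP-48 sub-row **(J-E′) «THE COARSE TABLES WITH A MOVING
# ONE-STEP BORDER»** at MODEL level (owner, gen 16): the jets of the four blocks of the bordered inverse along a curve `u ↦ kkt K(u) C(u)` in which the
# constraint moves too —
# `Γ̇ = −ΓK̇Γ − 𝓘ĊΓ − ΓĊᵀ𝓘ᴸ`, `𝓘̇ = −ΓK̇𝓘 − 𝓘Ċ𝓘 + ΓĊᵀ𝔊`, `𝓘̇ᴸ = −𝓘ᴸK̇Γ + 𝔊ĊΓ − 𝓘ᴸĊᵀ𝓘ᴸ`, **`𝔊̇ = 𝓘ᴸK̇𝓘 − 𝔊Ċ𝓘 − 𝓘ᴸĊᵀ𝔊`** —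
# the envelope theorem acquires the two BORDER words when the averaging depends on the background (`EffectiveFormJets` = the static case `Ċ = 0`)

HONEST DEPENDENCY (page 1, mandatory): continuum YM on T⁴ ⇐ BetaPertH ∧ nine spine estimates (0/9 proved); BetaPertH ⇐ (D1) ∧ (D4) ∧ CAP+tail;
G-an2-4 gates asym, D1 and NE2/3/4.  HONEST FRAMING (cell contract, verbatim): «discharging `BetaPertH` makes Bałaban's UV stability UNCONDITIONAL —
a real constructive-QFT result; it is NOT the continuum limit and NOT the Clay problem.»  THIS MODULE DISCHARGES NOTHING of the wall: it is [folklore]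
finite-dimensional calculus of the inverse matrix composed BY NAME from `CompositionSingular.kktInv_eq_fromBlocks ∕ kkt_eq_fromBlocks ∕ mul_minOp ∕ mul_flucCov`,
`D1BFx.LogDetSecondVariation.hasDerivAt_inv_entry` and `D1BFx.SliceTransferModel.hasDerivAt_kkt ∕ hasDerivAt_matMul ∕ hasDerivAt_transpose`.  No `def`,
no `def … : Prop`, nothing cited, 0 sorry; 0∕4 row-D1 binders; NOT the kernel-level coarse tables of the literal (rows (J-S)∕(J-W) of UNLIFT′), NOT SDF, NOT D1,
NOT BetaPertH, NOT continuum, NOT Clay.  «not in print; our bookkeeping».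

ABSOLUTE RULE (cell charter, verbatim): «No internally-minted statement may enter as a cited fact. Every hypothesis is either kernel-proved in this package or a
verbatim quotation of a PUBLISHED theorem with page reference. The manuscript(s) under audit are NOT citable for their own disputed steps — they are the thing
under adjudication; programme-internal (2001/route/tribunal) claims are never citable.»

WHY (RULING R-FP-48, journal [D1P3-G16-RFP48]; `NestedStepLawMovingBorder` §2–§3).  Under the factor cut the BLOCK factor of the nested step law is
`kkt (E(u)) (P(u))` with `E(u) = effForm (H u) (Q u) + G u` — the tree-level effective form of the ONE-STEP system whose border `Q(u) = DQ₁(U(u))` MOVES with the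
background (covariant averaging), plus the lifted multiplier term.  Row UNLIFT′ must identify the block factor's jets `Ė`, `Ë` («the coarse tables») with the
m-fold perfect system's own jets; the gen-15 file `EffectiveFormJets` supplies them for a STATIC border only (`𝔊̇ = 𝓘ᴸK̇𝓘`).  This file is the moving-border
version: the four block jets with their border words, the first jet of the effective form as a matrix curve near a non-degenerate point, and its SECOND jet by
Leibniz on `u ↦ 𝓘ᴸK̇𝓘 − 𝔊Ċ𝓘 − 𝓘ᴸĊᵀ𝔊` (every factor's jet supplied here, the product rule displayed).  CHECK (typed, §1): `Q·𝓘̇ = −Q̇·𝓘` and `Q·Γ̇ = −Q̇·Γ` — the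
derivative of the minimiser's constraint `Q𝓘 = 1` and of `QΓ = 0`.

CONTENTS ([folklore]; `ν` fine, `μ` block indices; `Γ = flucCov`, `𝓘 = minOp`, `𝓘ᴸ = minOpL`, `𝔊 = effForm` of `(K(t), C(t))`; `K̇ = K₁`, `Ċ = C₁`):
* §1 `kktInv_mul_kkt_mul_kktInv` — `𝕂⁻¹·kkt K̇ Ċ·𝕂⁻¹` in the four blocks (pure algebra, no invertibility); `constraint_minOpJet` ∕ `constraint_flucCovJet` — the
  two checks `C·(−ΓK̇𝓘 − 𝓘Ċ𝓘 + ΓĊᵀ𝔊) = −Ċ𝓘`, `C·(−ΓK̇Γ − 𝓘ĊΓ − ΓĊᵀ𝓘ᴸ) = −ĊΓ` under `det kkt ≠ 0`.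
* §2 entry and matrix-curve jets of the four blocks along `u ↦ (K u, C u)`: `hasDerivAt_kktInv_entry`, `hasDerivAt_flucCov(_entry)`, `hasDerivAt_minOp(_entry)`,
  `hasDerivAt_minOpL(_entry)`, **`hasDerivAt_effForm(_entry)`** (`𝔊̇ = 𝓘ᴸK̇𝓘 − 𝔊Ċ𝓘 − 𝓘ᴸĊᵀ𝔊`).
* §3 `eventually_hasDerivAt_effForm` (the first jet at every `u` near a non-degenerate `t`), **`hasDerivAt_effFormJet`** (THE SECOND JET of the effective form with a
  moving border: the derivative at `t` of the first-jet curve, every word displayed), `hasDerivAt_effForm_add` (the block curve `E = effForm K C + G` of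
  `NestedStepLawMovingBorder`: `Ė = 𝔊̇ + Ġ`).
Provenance: road FP OWNER b2b-balaban-beta-d1-p3 gen 16 (prover-b2b-balaban-beta-d1-p3-g16-0), 2026-08-21; R-FP-48 sub-row (J-E′) (model).  Orientation only (nothing
quoted is load-bearing): the objects are those of [Balaban1985BackgroundPropagators] §3 (3.126)–(3.148); this file's content is textbook calculus.
-/

noncomputable section

namespace Summit.QuantumFields.BalabanUV.Beta.FP.EffectiveFormJetsMovingBorder

open Matrix Filter Finset
open scoped Topology
open Literature.MathematicalPhysics.QuantumFieldTheory.Balaban1983to89.Beta.Composition (kkt)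
open Literature.MathematicalPhysics.QuantumFieldTheory.Balaban1983to89.Beta.CompositionSingular
  (effForm minOp minOpL flucCov kktInv_eq_fromBlocks kkt_eq_fromBlocks mul_minOp mul_flucCov)
open Literature.Analysis.Calculus (eventually_det_ne_zero)
open Summit.QuantumFields.BalabanUV.Beta.D1BFx.LogDetSecondVariation (hasDerivAt_inv_entry)
open Summit.QuantumFields.BalabanUV.Beta.D1BFx.SliceTransferModel (hasDerivAt_kkt hasDerivAt_matMul hasDerivAt_transpose hasDerivAt_entry)

/-! ## §1 Block algebra: the bordered inverse against a full bordered jet -/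

section Blocks

variable {𝕜 : Type*} [Field 𝕜]
variable {ν μ : Type*} [Fintype ν] [Fintype μ] [DecidableEq ν] [DecidableEq μ]

/-- [folklore] **`𝕂⁻¹·kkt K̇ Ċ·𝕂⁻¹` IN THE FOUR BLOCKS** (`𝕂 = kkt H C`; `Γ`, `𝓘`, `𝓘ᴸ`, `𝔊` its blocks; no invertibility needed):
`₁₁ = (ΓK̇ + 𝓘Ċ)Γ + ΓĊᵀ𝓘ᴸ`, `₁₂ = (ΓK̇ + 𝓘Ċ)𝓘 − ΓĊᵀ𝔊`, `₂₁ = (𝓘ᴸK̇ − 𝔊Ċ)Γ + 𝓘ᴸĊᵀ𝓘ᴸ`, `₂₂ = (𝓘ᴸK̇ − 𝔊Ċ)𝓘 − 𝓘ᴸĊᵀ𝔊`. -/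
theorem kktInv_mul_kkt_mul_kktInv (H K₁ : Matrix ν ν 𝕜) (C C₁ : Matrix μ ν 𝕜) :
    (kkt H C)⁻¹ * kkt K₁ C₁ * (kkt H C)⁻¹ =
      fromBlocks
        ((flucCov H C * K₁ + minOp H C * C₁) * flucCov H C + flucCov H C * C₁ᵀ * minOpL H C)
        ((flucCov H C * K₁ + minOp H C * C₁) * minOp H C - flucCov H C * C₁ᵀ * effForm H C)
        ((minOpL H C * K₁ - effForm H C * C₁) * flucCov H C + minOpL H C * C₁ᵀ * minOpL H C)
        ((minOpL H C * K₁ - effForm H C * C₁) * minOp H C - minOpL H C * C₁ᵀ * effForm H C) := by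
  rw [kktInv_eq_fromBlocks, kkt_eq_fromBlocks K₁, fromBlocks_multiply, fromBlocks_multiply]
  simp only [Matrix.mul_zero, add_zero, Matrix.neg_mul, Matrix.mul_neg]
  congr 1 <;> abel

/-- [folklore] **CHECK: the minimiser's jet keeps the constraint** — `C·(ΓK̇𝓘 + 𝓘Ċ𝓘 − ΓĊᵀ𝔊) = Ċ·𝓘`, i.e. with `𝓘̇ = −(…)`: `C𝓘̇ = −Ċ𝓘`, the derivative of
`C𝓘 = 1` (`mul_flucCov`, `mul_minOp`). -/
theorem constraint_minOpJet (H K₁ : Matrix ν ν 𝕜) (C C₁ : Matrix μ ν 𝕜) (h : IsUnit (kkt H C).det) :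
    C * ((flucCov H C * K₁ + minOp H C * C₁) * minOp H C - flucCov H C * C₁ᵀ * effForm H C) = C₁ * minOp H C := by
  rw [Matrix.mul_sub, ← Matrix.mul_assoc, Matrix.mul_add, ← Matrix.mul_assoc, ← Matrix.mul_assoc, mul_flucCov H C h, mul_minOp H C h,
    ← Matrix.mul_assoc, ← Matrix.mul_assoc, mul_flucCov H C h]
  simp

/-- [folklore] **CHECK: the fluctuation covariance's jet keeps the constraint** — `C·((ΓK̇ + 𝓘Ċ)Γ + ΓĊᵀ𝓘ᴸ) = Ċ·Γ`, i.e. `CΓ̇ = −ĊΓ`, the derivative of `CΓ = 0`. -/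
theorem constraint_flucCovJet (H K₁ : Matrix ν ν 𝕜) (C C₁ : Matrix μ ν 𝕜) (h : IsUnit (kkt H C).det) :
    C * ((flucCov H C * K₁ + minOp H C * C₁) * flucCov H C + flucCov H C * C₁ᵀ * minOpL H C) = C₁ * flucCov H C := by
  rw [Matrix.mul_add, ← Matrix.mul_assoc, Matrix.mul_add, ← Matrix.mul_assoc, ← Matrix.mul_assoc, mul_flucCov H C h, mul_minOp H C h,
    ← Matrix.mul_assoc, ← Matrix.mul_assoc, mul_flucCov H C h]
  simp

end Blocks

/-! ## §2 Entry jets and matrix-curve jets of the four blocks along a curve with moving border -/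

section EntryJets

variable {ν μ : Type*} [Fintype ν] [Fintype μ] [DecidableEq ν] [DecidableEq μ]
variable {K : ℝ → ν → ν → ℝ} {C : ℝ → μ → ν → ℝ} {K₁ : Matrix ν ν ℝ} {C₁ : Matrix μ ν ℝ} {t : ℝ}

/-- [folklore] Entry derivative of the bordered inverse along `u ↦ kkt K(u) C(u)`: `((𝕂⁻¹)ₖₗ)˙ = −(𝕂⁻¹·kkt K̇ Ċ·𝕂⁻¹)ₖₗ`. -/
theorem hasDerivAt_kktInv_entry (hK : HasDerivAt K (Matrix.of.symm K₁) t) (hC : HasDerivAt C (Matrix.of.symm C₁) t)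
    (hdet : (kkt (Matrix.of (K t)) (Matrix.of (C t))).det ≠ 0) (k l : ν ⊕ μ) :
    HasDerivAt (fun u => (kkt (Matrix.of (K u)) (Matrix.of (C u)))⁻¹ k l)
      (-((kkt (Matrix.of (K t)) (Matrix.of (C t)))⁻¹ * kkt K₁ C₁ * (kkt (Matrix.of (K t)) (Matrix.of (C t)))⁻¹) k l) t :=
  hasDerivAt_inv_entry (A := fun u => Matrix.of.symm (kkt (Matrix.of (K u)) (Matrix.of (C u)))) (A₁ := kkt K₁ C₁) (hasDerivAt_kkt hK hC) hdet k l

/-- [folklore] **`Γ̇ = −[(ΓK̇ + 𝓘Ċ)Γ + ΓĊᵀ𝓘ᴸ]`**, entrywise. -/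
theorem hasDerivAt_flucCov_entry (hK : HasDerivAt K (Matrix.of.symm K₁) t) (hC : HasDerivAt C (Matrix.of.symm C₁) t)
    (hdet : (kkt (Matrix.of (K t)) (Matrix.of (C t))).det ≠ 0) (i j : ν) :
    HasDerivAt (fun u => flucCov (Matrix.of (K u)) (Matrix.of (C u)) i j)
      (-((flucCov (Matrix.of (K t)) (Matrix.of (C t)) * K₁ + minOp (Matrix.of (K t)) (Matrix.of (C t)) * C₁) * flucCov (Matrix.of (K t)) (Matrix.of (C t))
          + flucCov (Matrix.of (K t)) (Matrix.of (C t)) * C₁ᵀ * minOpL (Matrix.of (K t)) (Matrix.of (C t))) i j) t := by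
  refine (hasDerivAt_kktInv_entry hK hC hdet (Sum.inl i) (Sum.inl j)).congr_deriv ?_
  simp only [kktInv_mul_kkt_mul_kktInv, fromBlocks_apply₁₁]

/-- [folklore] **`𝓘̇ = −[(ΓK̇ + 𝓘Ċ)𝓘 − ΓĊᵀ𝔊]`**, entrywise. -/
theorem hasDerivAt_minOp_entry (hK : HasDerivAt K (Matrix.of.symm K₁) t) (hC : HasDerivAt C (Matrix.of.symm C₁) t)
    (hdet : (kkt (Matrix.of (K t)) (Matrix.of (C t))).det ≠ 0) (i : ν) (j : μ) :
    HasDerivAt (fun u => minOp (Matrix.of (K u)) (Matrix.of (C u)) i j)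
      (-((flucCov (Matrix.of (K t)) (Matrix.of (C t)) * K₁ + minOp (Matrix.of (K t)) (Matrix.of (C t)) * C₁) * minOp (Matrix.of (K t)) (Matrix.of (C t))
          - flucCov (Matrix.of (K t)) (Matrix.of (C t)) * C₁ᵀ * effForm (Matrix.of (K t)) (Matrix.of (C t))) i j) t := by
  refine (hasDerivAt_kktInv_entry hK hC hdet (Sum.inl i) (Sum.inr j)).congr_deriv ?_
  simp only [kktInv_mul_kkt_mul_kktInv, fromBlocks_apply₁₂]

/-- [folklore] **`𝓘̇ᴸ = −[(𝓘ᴸK̇ − 𝔊Ċ)Γ + 𝓘ᴸĊᵀ𝓘ᴸ]`**, entrywise. -/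
theorem hasDerivAt_minOpL_entry (hK : HasDerivAt K (Matrix.of.symm K₁) t) (hC : HasDerivAt C (Matrix.of.symm C₁) t)
    (hdet : (kkt (Matrix.of (K t)) (Matrix.of (C t))).det ≠ 0) (i : μ) (j : ν) :
    HasDerivAt (fun u => minOpL (Matrix.of (K u)) (Matrix.of (C u)) i j)
      (-((minOpL (Matrix.of (K t)) (Matrix.of (C t)) * K₁ - effForm (Matrix.of (K t)) (Matrix.of (C t)) * C₁) * flucCov (Matrix.of (K t)) (Matrix.of (C t))
          + minOpL (Matrix.of (K t)) (Matrix.of (C t)) * C₁ᵀ * minOpL (Matrix.of (K t)) (Matrix.of (C t))) i j) t := by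
  refine (hasDerivAt_kktInv_entry hK hC hdet (Sum.inr i) (Sum.inl j)).congr_deriv ?_
  simp only [kktInv_mul_kkt_mul_kktInv, fromBlocks_apply₂₁]

/-- [folklore] **THE ENVELOPE THEOREM WITH A MOVING BORDER, entrywise: `𝔊̇ = (𝓘ᴸK̇ − 𝔊Ċ)𝓘 − 𝓘ᴸĊᵀ𝔊`** — the minimiser sandwich of the form's jet MINUS the two
border words. -/
theorem hasDerivAt_effForm_entry (hK : HasDerivAt K (Matrix.of.symm K₁) t) (hC : HasDerivAt C (Matrix.of.symm C₁) t)
    (hdet : (kkt (Matrix.of (K t)) (Matrix.of (C t))).det ≠ 0) (i j : μ) :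
    HasDerivAt (fun u => effForm (Matrix.of (K u)) (Matrix.of (C u)) i j)
      (((minOpL (Matrix.of (K t)) (Matrix.of (C t)) * K₁ - effForm (Matrix.of (K t)) (Matrix.of (C t)) * C₁) * minOp (Matrix.of (K t)) (Matrix.of (C t))
          - minOpL (Matrix.of (K t)) (Matrix.of (C t)) * C₁ᵀ * effForm (Matrix.of (K t)) (Matrix.of (C t))) i j) t := by
  have h := (hasDerivAt_kktInv_entry hK hC hdet (Sum.inr i) (Sum.inr j)).neg
  have h' : HasDerivAt (fun u => effForm (Matrix.of (K u)) (Matrix.of (C u)) i j)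
      (-(-((kkt (Matrix.of (K t)) (Matrix.of (C t)))⁻¹ * kkt K₁ C₁ * (kkt (Matrix.of (K t)) (Matrix.of (C t)))⁻¹) (Sum.inr i) (Sum.inr j))) t :=
    h.congr_of_eventuallyEq (Eventually.of_forall fun u => rfl)
  refine h'.congr_deriv ?_
  simp only [kktInv_mul_kkt_mul_kktInv, fromBlocks_apply₂₂, neg_neg]

/-- [folklore] `Γ̇` as a matrix curve. -/
theorem hasDerivAt_flucCov (hK : HasDerivAt K (Matrix.of.symm K₁) t) (hC : HasDerivAt C (Matrix.of.symm C₁) t)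
    (hdet : (kkt (Matrix.of (K t)) (Matrix.of (C t))).det ≠ 0) :
    HasDerivAt (fun u => Matrix.of.symm (flucCov (Matrix.of (K u)) (Matrix.of (C u))))
      (Matrix.of.symm (-((flucCov (Matrix.of (K t)) (Matrix.of (C t)) * K₁ + minOp (Matrix.of (K t)) (Matrix.of (C t)) * C₁)
          * flucCov (Matrix.of (K t)) (Matrix.of (C t))
          + flucCov (Matrix.of (K t)) (Matrix.of (C t)) * C₁ᵀ * minOpL (Matrix.of (K t)) (Matrix.of (C t))))) t :=
  hasDerivAt_pi.2 fun i => hasDerivAt_pi.2 fun j => hasDerivAt_flucCov_entry hK hC hdet i j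

/-- [folklore] `𝓘̇` as a matrix curve. -/
theorem hasDerivAt_minOp (hK : HasDerivAt K (Matrix.of.symm K₁) t) (hC : HasDerivAt C (Matrix.of.symm C₁) t)
    (hdet : (kkt (Matrix.of (K t)) (Matrix.of (C t))).det ≠ 0) :
    HasDerivAt (fun u => Matrix.of.symm (minOp (Matrix.of (K u)) (Matrix.of (C u))))
      (Matrix.of.symm (-((flucCov (Matrix.of (K t)) (Matrix.of (C t)) * K₁ + minOp (Matrix.of (K t)) (Matrix.of (C t)) * C₁)
          * minOp (Matrix.of (K t)) (Matrix.of (C t))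
          - flucCov (Matrix.of (K t)) (Matrix.of (C t)) * C₁ᵀ * effForm (Matrix.of (K t)) (Matrix.of (C t))))) t :=
  hasDerivAt_pi.2 fun i => hasDerivAt_pi.2 fun j => hasDerivAt_minOp_entry hK hC hdet i j

/-- [folklore] `𝓘̇ᴸ` as a matrix curve. -/
theorem hasDerivAt_minOpL (hK : HasDerivAt K (Matrix.of.symm K₁) t) (hC : HasDerivAt C (Matrix.of.symm C₁) t)
    (hdet : (kkt (Matrix.of (K t)) (Matrix.of (C t))).det ≠ 0) :
    HasDerivAt (fun u => Matrix.of.symm (minOpL (Matrix.of (K u)) (Matrix.of (C u))))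
      (Matrix.of.symm (-((minOpL (Matrix.of (K t)) (Matrix.of (C t)) * K₁ - effForm (Matrix.of (K t)) (Matrix.of (C t)) * C₁)
          * flucCov (Matrix.of (K t)) (Matrix.of (C t))
          + minOpL (Matrix.of (K t)) (Matrix.of (C t)) * C₁ᵀ * minOpL (Matrix.of (K t)) (Matrix.of (C t))))) t :=
  hasDerivAt_pi.2 fun i => hasDerivAt_pi.2 fun j => hasDerivAt_minOpL_entry hK hC hdet i j

/-- [folklore] **`𝔊̇ = (𝓘ᴸK̇ − 𝔊Ċ)𝓘 − 𝓘ᴸĊᵀ𝔊`** as a matrix curve (the envelope theorem with a moving border). -/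
theorem hasDerivAt_effForm (hK : HasDerivAt K (Matrix.of.symm K₁) t) (hC : HasDerivAt C (Matrix.of.symm C₁) t)
    (hdet : (kkt (Matrix.of (K t)) (Matrix.of (C t))).det ≠ 0) :
    HasDerivAt (fun u => Matrix.of.symm (effForm (Matrix.of (K u)) (Matrix.of (C u))))
      (Matrix.of.symm ((minOpL (Matrix.of (K t)) (Matrix.of (C t)) * K₁ - effForm (Matrix.of (K t)) (Matrix.of (C t)) * C₁)
          * minOp (Matrix.of (K t)) (Matrix.of (C t))
          - minOpL (Matrix.of (K t)) (Matrix.of (C t)) * C₁ᵀ * effForm (Matrix.of (K t)) (Matrix.of (C t)))) t :=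
  hasDerivAt_pi.2 fun i => hasDerivAt_pi.2 fun j => hasDerivAt_effForm_entry hK hC hdet i j

end EntryJets

/-! ## §3 The first jet near a non-degenerate point; the second jet of the effective form; the block curve `E = 𝔊 + G` -/

section SecondJet

variable {ν μ : Type*} [Fintype ν] [Fintype μ] [DecidableEq ν] [DecidableEq μ]

/-- [folklore] **THE FIRST JET NEAR A NON-DEGENERATE POINT**: if `K`, `C` have first jets `K₁ u`, `C₁ u` at every `u` near `t` and the bordered system is
non-degenerate at `t`, then at every `u` near `t` the effective form has derivative `(𝓘ᴸ(u)K₁(u) − 𝔊(u)C₁(u))𝓘(u) − 𝓘ᴸ(u)C₁(u)ᵀ𝔊(u)`. -/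
theorem eventually_hasDerivAt_effForm {K K₁ : ℝ → ν → ν → ℝ} {C C₁ : ℝ → μ → ν → ℝ} {t : ℝ}
    (hK : ∀ᶠ u in 𝓝 t, HasDerivAt K (K₁ u) u) (hC : ∀ᶠ u in 𝓝 t, HasDerivAt C (C₁ u) u)
    (hdet : (kkt (Matrix.of (K t)) (Matrix.of (C t))).det ≠ 0) :
    ∀ᶠ u in 𝓝 t, HasDerivAt (fun v => Matrix.of.symm (effForm (Matrix.of (K v)) (Matrix.of (C v))))
      ((fun u => Matrix.of.symm
        ((minOpL (Matrix.of (K u)) (Matrix.of (C u)) * Matrix.of (K₁ u) - effForm (Matrix.of (K u)) (Matrix.of (C u)) * Matrix.of (C₁ u))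
            * minOp (Matrix.of (K u)) (Matrix.of (C u))
          - minOpL (Matrix.of (K u)) (Matrix.of (C u)) * (Matrix.of (C₁ u))ᵀ * effForm (Matrix.of (K u)) (Matrix.of (C u)))) u) u := by
  have hKt : HasDerivAt K (Matrix.of.symm (Matrix.of (K₁ t))) t := hK.self_of_nhds
  have hCt : HasDerivAt C (Matrix.of.symm (Matrix.of (C₁ t))) t := hC.self_of_nhds
  have hne : ∀ᶠ u in 𝓝 t, (Matrix.of (Matrix.of.symm (kkt (Matrix.of (K u)) (Matrix.of (C u))))).det ≠ 0 :=
    eventually_det_ne_zero (hasDerivAt_kkt hKt hCt).hasFDerivAt hdet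
  filter_upwards [hK, hC, hne] with u huK huC hune
  have huK' : HasDerivAt K (Matrix.of.symm (Matrix.of (K₁ u))) u := huK
  have huC' : HasDerivAt C (Matrix.of.symm (Matrix.of (C₁ u))) u := huC
  exact hasDerivAt_effForm huK' huC' hune

/-- [folklore] **THE SECOND JET OF THE EFFECTIVE FORM WITH A MOVING BORDER**: the derivative at `t` of the first-jet curve
`u ↦ (𝓘ᴸ(u)K₁(u) − 𝔊(u)C₁(u))·𝓘(u) − 𝓘ᴸ(u)·C₁(u)ᵀ·𝔊(u)`, by the product rule with every factor's jet from §2 (`K₁`, `C₁` the first-jet curves with derivatives `K₂`, `C₂` at `t`;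
blocks and their jets at `(K t, C t)`).  Every word is displayed; the static case `C₁ ≡ 0`, `C₂ = 0` is `EffectiveFormJets.hasDerivAt_effFormJet`. -/
theorem hasDerivAt_effFormJet {K K₁ : ℝ → ν → ν → ℝ} {K₂ : Matrix ν ν ℝ} {C C₁ : ℝ → μ → ν → ℝ} {C₂ : Matrix μ ν ℝ} {t : ℝ}
    (hK : HasDerivAt K (K₁ t) t) (hK₁ : HasDerivAt K₁ (Matrix.of.symm K₂) t) (hC : HasDerivAt C (C₁ t) t) (hC₁ : HasDerivAt C₁ (Matrix.of.symm C₂) t)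
    (hdet : (kkt (Matrix.of (K t)) (Matrix.of (C t))).det ≠ 0)
    -- the blocks and their jets at `t`, NAMED
    {Γ : Matrix ν ν ℝ} {I : Matrix ν μ ℝ} {L : Matrix μ ν ℝ} {S : Matrix μ μ ℝ} {A : Matrix ν ν ℝ} {B : Matrix μ ν ℝ}
    (hΓ : flucCov (Matrix.of (K t)) (Matrix.of (C t)) = Γ) (hI : minOp (Matrix.of (K t)) (Matrix.of (C t)) = I)
    (hL : minOpL (Matrix.of (K t)) (Matrix.of (C t)) = L) (hS : effForm (Matrix.of (K t)) (Matrix.of (C t)) = S)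
    (hA : Matrix.of (K₁ t) = A) (hB : Matrix.of (C₁ t) = B) :
    HasDerivAt (fun u => Matrix.of.symm
        ((minOpL (Matrix.of (K u)) (Matrix.of (C u)) * Matrix.of (K₁ u) - effForm (Matrix.of (K u)) (Matrix.of (C u)) * Matrix.of (C₁ u))
            * minOp (Matrix.of (K u)) (Matrix.of (C u))
          - minOpL (Matrix.of (K u)) (Matrix.of (C u)) * (Matrix.of (C₁ u))ᵀ * effForm (Matrix.of (K u)) (Matrix.of (C u))))
      (Matrix.of.symm
        (((-((L * A - S * B) * Γ + L * Bᵀ * L) * A + L * K₂ - (((L * A - S * B) * I - L * Bᵀ * S) * B + S * C₂)) * I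
            + (L * A - S * B) * (-((Γ * A + I * B) * I - Γ * Bᵀ * S)))
          - ((-((L * A - S * B) * Γ + L * Bᵀ * L) * Bᵀ + L * C₂ᵀ) * S + L * Bᵀ * ((L * A - S * B) * I - L * Bᵀ * S)))) t := by
  have hK' : HasDerivAt K (Matrix.of.symm (Matrix.of (K₁ t))) t := hK
  have hC' : HasDerivAt C (Matrix.of.symm (Matrix.of (C₁ t))) t := hC
  have hLd := hasDerivAt_minOpL hK' hC' hdet
  have hId := hasDerivAt_minOp hK' hC' hdet
  have hSd := hasDerivAt_effForm hK' hC' hdet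
  simp only [hΓ, hI, hL, hS, hA, hB] at hLd hId hSd
  -- `u ↦ 𝓘ᴸ K₁`
  have h1 := hasDerivAt_matMul (X := fun u => Matrix.of.symm (minOpL (Matrix.of (K u)) (Matrix.of (C u)))) (Y := K₁) hLd hK₁
  -- `u ↦ 𝔊 C₁`
  have h2 := hasDerivAt_matMul (X := fun u => Matrix.of.symm (effForm (Matrix.of (K u)) (Matrix.of (C u)))) (Y := C₁) hSd hC₁
  -- `u ↦ (𝓘ᴸ K₁ − 𝔊 C₁) 𝓘`
  have h3 := hasDerivAt_matMul (X := fun u => Matrix.of.symm (Matrix.of (Matrix.of.symm (minOpL (Matrix.of (K u)) (Matrix.of (C u)))) * Matrix.of (K₁ u)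
      - Matrix.of (Matrix.of.symm (effForm (Matrix.of (K u)) (Matrix.of (C u)))) * Matrix.of (C₁ u)))
    (Y := fun u => Matrix.of.symm (minOp (Matrix.of (K u)) (Matrix.of (C u)))) (h1.sub h2) hId
  -- `u ↦ 𝓘ᴸ C₁ᵀ`
  have h4 := hasDerivAt_matMul (X := fun u => Matrix.of.symm (minOpL (Matrix.of (K u)) (Matrix.of (C u))))
    (Y := fun u => Matrix.of.symm (Matrix.of (C₁ u))ᵀ) hLd (hasDerivAt_transpose hC₁)
  -- `u ↦ 𝓘ᴸ C₁ᵀ 𝔊`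
  have h5 := hasDerivAt_matMul (X := fun u => Matrix.of.symm (Matrix.of (Matrix.of.symm (minOpL (Matrix.of (K u)) (Matrix.of (C u)))) *
      Matrix.of (Matrix.of.symm (Matrix.of (C₁ u))ᵀ)))
    (Y := fun u => Matrix.of.symm (effForm (Matrix.of (K u)) (Matrix.of (C u)))) h4 hSd
  have h := h3.sub h5
  simp only [Equiv.apply_symm_apply, hL, hI, hS, hA, hB] at h
  exact h

/-- [folklore] **THE BLOCK CURVE OF THE NESTED STEP LAW**: `E(u) := effForm (K u) (C u) + G u` has derivative `𝔊̇ + Ġ` (for `NestedStepLawMovingBorder`'s `hE`). -/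
theorem hasDerivAt_effForm_add {K : ℝ → ν → ν → ℝ} {C : ℝ → μ → ν → ℝ} {G : ℝ → μ → μ → ℝ} {K₁ : Matrix ν ν ℝ} {C₁ : Matrix μ ν ℝ}
    {G₁ : Matrix μ μ ℝ} {t : ℝ}
    (hK : HasDerivAt K (Matrix.of.symm K₁) t) (hC : HasDerivAt C (Matrix.of.symm C₁) t) (hG : HasDerivAt G (Matrix.of.symm G₁) t)
    (hdet : (kkt (Matrix.of (K t)) (Matrix.of (C t))).det ≠ 0) :
    HasDerivAt (fun u => Matrix.of.symm (effForm (Matrix.of (K u)) (Matrix.of (C u)) + Matrix.of (G u)))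
      (Matrix.of.symm ((minOpL (Matrix.of (K t)) (Matrix.of (C t)) * K₁ - effForm (Matrix.of (K t)) (Matrix.of (C t)) * C₁)
          * minOp (Matrix.of (K t)) (Matrix.of (C t))
          - minOpL (Matrix.of (K t)) (Matrix.of (C t)) * C₁ᵀ * effForm (Matrix.of (K t)) (Matrix.of (C t)) + G₁)) t := by
  have h := (hasDerivAt_effForm hK hC hdet).add hG
  refine HasDerivAt.congr_deriv (h.congr_of_eventuallyEq (Eventually.of_forall fun u => ?_)) ?_
  · funext i j
    simp only [Pi.add_apply, Matrix.of_symm_apply, Matrix.add_apply, Matrix.of_apply]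
  · funext i j
    simp only [Pi.add_apply, Matrix.of_symm_apply, Matrix.add_apply]

end SecondJet

end Summit.QuantumFields.BalabanUV.Beta.FP.EffectiveFormJetsMovingBorder

end
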